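/- Copyright: the b2b-balaban cell (near-miss cell 7), T⁴-continuum fan-out; row NE7b CRUX team (2), seat
t4-ne7b-formalise-leaf-05 (gen 33) — IR-46-2's standing division «… leaf-05 toy-instantiates» (`HOME/INBOX.md` l.9196)
applied to the OWNER's SPEC D-48-1 «THE PREFIX TWIN» (custodian leaf-03 g27: FILE 1 p289955, FILE 2 p290621), part 6 of the
sanity series (`CLAIMS.log` l.33727).  Released under the licence of the surrounding project. -/
import Summits.QuantumFields.BalabanUV.T4Continuum.Support.HistoryRealiseCellsRunAssemblyWTVSSanityLW

/-!
# Sanity for the (α) assembly, part 6: THE PREFIX-TWIN RECORD `HistReadDataLW` ON THE TOY READING OF CONSTANT SIZE, FOR ANY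
DATUM, FROM PART 2's DISPLAYED INPUTS (companion of `HistoryRealiseCellsRunAssemblyWTVSDataLW`; lineage
`t4-ne7b-formalise-leaf-05` gen 33; part 5 = `…SanityLW` (reading `ℛ₄`, letters `Φ₄`, constants `C₃`); part 7 =
`…SanityLWEnd` (the record with NO datum hypothesis on the cell's toy datum; FILE 2's `toL` ∕ END run BY NAME))

Summits-side support leaf of the T⁴-continuum cell (rung (B)+1 on a FINITE torus only; NOT infinite volume, NOT the
mass gap, NOT Clay; NOT a proof of NE7b — the cell's OWN estimate, NOT PRINTED, NOT PROVED).  [folklore] ONE `def` (a term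
of FILE 1's `structure HistReadDataLW`, 120 fields) over parts 1–2–5, REUSED BY NAME; nothing printed asserted, no
`def … : Prop` fact, no cite-tagged hypothesis, zero `sorry`.

WHAT.  **`histReadDataLW₄`**: the 120-field record on ANY datum `D` with measurable averagings, run A's and run B's
operations := the toy (1.72)-expansions `toyR (ZD D g₀ os K t)` of the datum's OWN dressed generating functions (H2A∕H2B∕
«(1.72) holds»∕integrability discharged for every datum), every reading-level field discharged on `ℛ₄ F.L Rc` ∕ `Φ₄`
(part 5) — `hΛ` by the pin `log_lamVol`, `hF` at the FIXED letter `S_h` and `hsB`∕`hsB′` at the floor `sBsharp` by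
exponentiation, φ-shares `0` under the multiplier `Φ ≥ 0` (`dshare_nonneg`), `m := A₁²`, `hAp` from the signs
(`ApFlat_ne_zero`), (2.9) on constant sizes, the key-indexed fields (ρ)∕(ρ′)∕«TRUNC» VACUOUS (no live name) —, PARAMETRIC
in `(C, O)` under their sign letters (`13 ≤ n₁`, `0 < E₂`, `0 < E₃`, `1 ≤ p₀`, `0 < A₀`; `0 < γ₀`, `A₁ ≠ 0`, `0 < M`,
`β₀(d+2) ≤ 1`) and in the census letters `p₁ η η′ κ κ₂ κᵥ` under the five identities + gaps, from EXACTLY: `hM`, the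
K-uniform envelope `hZ`, (2.5) `isRj` at the size `Rc`, the twin's two new per-cutoff displays read on the datum's
couplings — `1 ≤ lamVol cΛ (flow K) K t` and (2.7) `h27` at `β′ = 0`, power `1`, the record's `β₀ ≥ 0` —, the (γ) floors and site budgets,
and the S-rows (NE7c shells, NE7 budget, four summable rates) as PARAMETERS.

HONEST.  A node test of a hypothesis SHAPE at TOY letters (c2): every R∕S field of `HistReadDataLW` stays a HYPOTHESIS of
the assembly for real data; nothing of Bałaban's read, asserted or contested; BY-NAME EFFECT ON THE WALL: NONE; NE7b NOT
proved; spine 0∕9.  HONEST DEPENDENCY (cell): continuum YM on T⁴ ⇐ BetaPertH ∧ nine spine estimates (0/9 proved); BetaPertH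
⇐ (D1) ∧ (D4) ∧ CAP+tail; G-an2-4 gates asym, D1 and NE2/3/4.  Unchanged here.
-/

open Finset MeasureTheory
open Literature.MathematicalPhysics.QuantumFieldTheory.Balaban1983to89
open Literature.MathematicalPhysics.QuantumFieldTheory.Balaban1983to89.B16SProfile (DropCtl)
open T4PersistenceDictionary T4PersistentHistoryCount T4BankedInduction T4PrintedShapeBanking
open T4WeightBudget T4GlobalDenominator T4LiveClassFibration T4LiveStructureGas T4LiveGasToTerms T4RecordPriceSeam
open T4PartnerMultiplicity T4IndicatorShell T4MatchingAssembly T4MatchingClosure T4MatchingClosureSocket T4Continuum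
open T4StabilitySocket T4BranchingRecordsGas T4TaggedShapeBanking T4CanonicalMenus T4RenewalChains
open Summit.QuantumFields.BalabanUV.T4Continuum.HistoryFlow Summit.QuantumFields.BalabanUV.T4Continuum.HistoryGen
open Summit.QuantumFields.BalabanUV.T4Continuum.HistoryAdmissible
open Summit.QuantumFields.BalabanUV.T4Continuum.HistoryGenealogyExtraction
open Summit.QuantumFields.BalabanUV.T4Continuum.HistoryGenealogyRealise
open Summit.QuantumFields.BalabanUV.T4Continuum.HistoryGenealogyInstantiate
open Summit.QuantumFields.BalabanUV.T4Continuum.HistoryGenealogyPedigree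
open Summit.QuantumFields.BalabanUV.T4Continuum.HistoryAssemblyPedigree Summit.QuantumFields.BalabanUV.T4Continuum.HistoryAssemblyTerms
open Summit.QuantumFields.BalabanUV.T4Continuum.HistoryAssemblyMult Summit.QuantumFields.BalabanUV.T4Continuum.HistoryAssemblyMultKey
open Summit.QuantumFields.BalabanUV.T4Continuum.HistoryAssemblyRealiseRun Summit.QuantumFields.BalabanUV.T4Continuum.HistorySocketTH
open Summit.QuantumFields.BalabanUV.T4Continuum.HistoryRealiseDistinct
open Summit.QuantumFields.BalabanUV.T4Continuum.HistoryRealiseCellsRunApexT3bWTVS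
open Summit.QuantumFields.BalabanUV.T4Continuum.B16HistoryIndexedRepr
open Summit.QuantumFields.BalabanUV.T4Continuum.B16HistoryIndexedTrunc
open Summit.QuantumFields.BalabanUV.T4Continuum.HistoryBankingLE Summit.QuantumFields.BalabanUV.T4Continuum.HistoryBankingVolumePlug
open Summit.QuantumFields.BalabanUV.T4Continuum.HistoryConstants Summit.QuantumFields.BalabanUV.T4Continuum.HistoryBankingDiscountCharge
open Summit.QuantumFields.BalabanUV.T4Continuum.HistoryBankingCreditRead Summit.QuantumFields.BalabanUV.T4Continuum.HistoryBankingFibreRoom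
open Summit.QuantumFields.BalabanUV.T4Continuum.HistoryPriceNodeSum Summit.QuantumFields.BalabanUV.T4Continuum.HistoryPriceKeys
open Summit.QuantumFields.BalabanUV.T4Continuum.HistoryRealiseCellsRunSupplyWTVS
open Summit.QuantumFields.BalabanUV.T4Continuum.HistoryRealiseCellsRunSupplyKeysWTVS
open Summit.QuantumFields.BalabanUV.T4Continuum.HistoryRealiseCellsRunSupplyWTVSSanity
open Summit.QuantumFields.BalabanUV.T4Continuum.HistoryRealiseCellsRunSupplyKeysWTVSSanity
open Summit.QuantumFields.BalabanUV.T4Continuum.HistoryRealiseCellsRunAssemblyWTVSData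
open Summit.QuantumFields.BalabanUV.T4Continuum.HistoryRealiseCellsRunAssemblyWTVS
open Summit.QuantumFields.BalabanUV.T4Continuum.HistoryRealiseCellsRunAssemblyWTVSDataL
open Summit.QuantumFields.BalabanUV.T4Continuum.HistoryRealiseCellsRunAssemblyWTVSDataLW
open Summit.QuantumFields.BalabanUV.T4Continuum.HistoryBankingSharpShares (ell sBsharp)
open Summit.QuantumFields.BalabanUV.T4Continuum.HistoryBankingRoundingUnrounded (sRunr ApFlat)
open Summit.QuantumFields.BalabanUV.T4Continuum.HistoryBankingVolumeWindow (uvol lamVol log_lamVol one_le_lamVol)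

namespace Summit.QuantumFields.BalabanUV.T4Continuum.HistoryRealiseCellsRunAssemblyWTVSSanity

noncomputable section

open B16HistoryIndexedRepr.Sanity B16HistoryIndexedRepr.SanityInput HistoryConstants.Sanity HistoryBankingCreditRead.Sanity

-- the structural `DecidableEq` instance of the concrete tag type exceeds the default synthesis size (as in the siblings)
set_option synthInstance.maxSize 1024

/-! ## §4 The prefix-twin record on the toy reading, for any datum, from the displayed inputs -/

section Record

variable {F : T4Family} {G : Type*} [GaugeGroup G] [MeasurableSpace G] [HaarData G] [RegularGaugeGroup G]

/-- **THE PREFIX-TWIN RECORD `HistReadDataLW` INHABITED ON THE TOY READING OF CONSTANT SIZE `Rc`**, run A's and run B's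
operations := the toy (1.72)-expansions `toyR (ZD D g₀ os K t)` of the datum's OWN dressed generating functions (H2A∕H2B∕
«(1.72) holds»∕integrability discharged for every datum), every reading-level field discharged on `ℛ₄ F.L Rc` ∕ `Φ₄` —
`hΛ` by the pin, `hF` at `S_h` and `hsB`∕`hsB′` at the floor by exponentiation, φ-shares `0` under the multiplier `Φ`,
`m := A₁²`, (2.9) on constant sizes —, PARAMETRIC in `(C, O)` under their sign letters and in the census letters under the
five identities + gaps, from EXACTLY: measurable averagings `hM`, the K-uniform envelope `hZ`, (2.5) `isRj` at the size
`Rc`, the pinned cost `1 ≤ lamVol` and (2.7) `h27` (at `β′ = 0`, power `1`, any `β₀ ≥ 0`) on the datum's couplings, the (γ)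
floors and site budgets, and the S-rows as PARAMETERS (`β′ := 0`; (2.9) on constant sizes for any `β₀`). [folklore] -/
def histReadDataLW₄ (D : FiniteEpsData F G) (hM : D.AvgMeasurable) {C : T4PrintedShapeBanking.Consts} {O : PrintedO1s}
    (hn₁ : 13 ≤ C.n₁) (hE₂ : 0 < C.E₂) (hE₃ : 0 < C.E₃) (hp₀ : 1 ≤ C.p₀) (hA₀ : 0 < C.A₀) (hγ₀ : 0 < O.γ₀)
    (hA₁ : O.A₁ ≠ 0) (hMO : 0 < O.M) (hβd : O.β₀ * ((O.d : ℝ) + 2) ≤ 1) {θv : ℝ} (hθv : 0 < θv) (rr n : ℕ)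
    (hn : 0 < n) (g₀ : ℕ → ℝ) (os : List (ULoop F)) {Rc : ℕ} (hRc : 2 ≤ Rc) {cΛ Lr Φ β₀ : ℝ} (hcΛ : 0 ≤ cΛ)
    (hLr : 0 ≤ Lr) (hΦ : 0 ≤ Φ) (hβ₀ : 0 ≤ β₀) {p₁ η η' κ κ₂ κᵥ : ℕ} (hexpR : C.p₀ + rr * (O.d + 3) + η = 2 * p₁)
    (hexpR' : rr * (C.q' + 1) + rr * (O.d + 3) + η' = 2 * p₁) (hexpB : rr * (C.q' + 1) + κ = 2 * C.p₀)
    (hexpF : 1 + κ₂ = rr * C.q') (hexpV : 1 + κᵥ = 2 * C.p₀) (hη : 1 ≤ η) (hη' : 1 ≤ η') (hκ : 1 ≤ κ) (hκ₂ : 1 ≤ κ₂)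
    (hκᵥ : 1 ≤ κᵥ) {Zi : ℝ} (hZ : ∀ K t, |t| ≤ 1 → ZD D g₀ os K t ≤ Zi)
    (isRj : ∀ K s, s ≤ K → B14.IsRj F.L rr ((D.C ⟨K, F.m, g₀ K⟩).flow.g s) Rc)
    (hΛ1 : ∀ K t, 1 ≤ lamVol cΛ (D.C ⟨K, F.m, g₀ K⟩).flow.g K t)
    (h27 : ∀ K, B14.FlowIneq27 (D.C ⟨K, F.m, g₀ K⟩).flow.g 0 β₀ 1 K)
    {c₀ n₁ : ℝ} (c₀_pos : 0 < c₀) (floor : ∀ K, c₀ ≤ smallFieldMass D K (g₀ K))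
    (floor' : ∀ K, c₀ ≤ smallFieldMass D (K + 1) (g₀ (K + 1)))
    (sites : ∀ K, ((D.C ⟨K, F.m, g₀ K⟩).numSites K : ℝ) ≤ n₁)
    (sites' : ∀ K, ((D.C ⟨K + 1, F.m, g₀ (K + 1)⟩).numSites (K + 1) : ℝ) ≤ n₁)
    {shA shB : ℕ → ℝ → HIndex.Idx Isk → ℝ} {Wsh : ℕ → ℝ}
    (shell : ShellWeightBound 1 (HIndex.termSet Isk)
      (fun _ t => Repr172R.weight μ₀ (fun K t => toyR (ZD D g₀ os K t)) t)
      (weightB μ₀ (fun K t => toyR (ZD D g₀ os K t)) trunc₃) shA shB Wsh)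
    {Cc Rr CcRec RrRec : ℕ → ℝ → HIndex.Idx Isk → ℝ} {ν u s₂ q₀ r s : ℕ → ℝ}
    (budget : ReindexedBudget 1 1 (HIndex.termSet Isk)
      (fun K t τ => Repr172R.weight μ₀ (fun K t => toyR (ZD D g₀ os K t)) t τ - shA K t τ)
      (fun K t τ => weightB μ₀ (fun K t => toyR (ZD D g₀ os K t)) trunc₃ K t τ - shB K t τ)
      (badOfClass (bstrOf Prod.fst (memA n F.L (ℛ₄ F.L Rc))) (HIndex.termSet Isk)
        (fun K _ => badClasses Prod.fst (memA n F.L (ℛ₄ F.L Rc)) jhalf (HIndex.termSet Isk) K))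
      Cc Rr CcRec RrRec ν u s₂ q₀ r s)
    (sum_r : Summable r) (sum_u : Summable u) (sum_s : Summable s) (sum_s₂ : Summable s₂) :
    HistReadDataLW D C O θv rr 1 n hn g₀ os cΛ Lr Φ β₀ p₁ η η' κ κ₂ κᵥ Isk Isk (fun _ => Unit) μ₀
      (fun _ => GoodClass.top Unit) (fun _ => Unit) μ₀ (fun _ => GoodClass.top Unit) where
  l₀ := 1
  vol := 1
  l₀_pos := one_pos
  vol_pos := one_pos
  K₀ := 0
  RA K t := toyR (ZD D g₀ os K t)
  ρA K t V := ∑ a : (Isk K).Adm, (toyR (ZD D g₀ os K t)).term a V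
  holdsA _ _ _ := rfl
  intA _ _ _ _ _ := Integrable.of_finite
  H2A K t _ _ := by
    show ZD D g₀ os K t = ∫ x, ∑ a : (Isk K).Adm, (toyR (ZD D g₀ os K t)).term a x ∂(Measure.dirac ())
    rw [MeasureTheory.integral_dirac, sum_term_toyR (ZD_pos D hM g₀ os K t)]
  ℛ := ℛ₄ F.L Rc
  hL := rfl
  hs := rfl
  Φf := Φ₄ O (O.A₁ ^ 2) C Lr p₁ Rc cΛ (fun K => (D.C ⟨K, F.m, g₀ K⟩).flow.g) (ZD D g₀ os) hΛ1
  hR := histRead_toy₄ O (O.A₁ ^ 2) C Lr p₁ Rc cΛ _ (ZD D g₀ os) hΛ1 F.L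
  isRj := isRj
  one_le_R _ _ _ := le_trans one_le_two hRc
  hL4 := HistoryRealiseCellsRunPinned.four_le_L F
  hprof K _ t _ := runProfile_succ_le_toy₄ F.L Rc K t
  hdrop K _ m := dropCtl_runProfile_toy₄ F.L Rc K m
  hN K _ τ _ := newOK_run₄ F.L Rc K τ
  hRm K _ τ _ := rm_le_run₄ F.L hRc K τ
  hRmS K _ τ _ := rmS_run₄ F.L hRc K τ
  hRm2 K _ τ _ := rm2_run₄ F.L Rc K τ
  hD K _ τ _ := newDisjoint_run₄ F.L Rc K τ
  hreg K _ τ _ := regionsInBox_run₄ F.L Rc n K τ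
  hn₁ := hn₁
  hE₂ := hE₂
  hE₃pos := hE₃
  sB K := sBsharp O (O.A₁ ^ 2) C (D.C ⟨K, F.m, g₀ K⟩).flow.g
  φB _ _ _ := 0
  φR _ _ := 0
  β' := 0
  hF K _ := factorRead_toy₄ O (O.A₁ ^ 2) C Lr p₁ Rc cΛ _ (ZD D g₀ os) hΛ1 F.L K
  h29 K _ := flow29_const₄ (le_trans (by norm_num) (two_le_L F)) _ β₀ K
  W _ := 2
  one_le_W _ := one_le_two
  Wi := 2
  BAi := Real.log (Zi / 6)
  mi := 1
  hWi _ := le_rfl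
  hBA K _ ht _ := BA_le_of_le₄ O (O.A₁ ^ 2) C Lr p₁ Rc cΛ _ hΛ1 (fun K t _ => ZD_pos D hM g₀ os K t) hZ K ht
  hmi K := le_of_eq (by simp [μ₀])
  hρ K _ _ _ k hk := absurd hk (not_mem_badGMems₄ F.L Rc _ _ jhalf K k)
  c₀ := c₀
  n₁ := n₁
  c₀_pos := c₀_pos
  floor K _ := floor K
  floor' K _ := floor' K
  sites K _ := sites K
  sites' K _ := sites' K
  RB K t := toyR (ZD D g₀ os K t)
  ρB K t V := ∑ a : (Isk (K + 1)).Adm, (toyR (ZD D g₀ os (K + 1) t)).term a V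
  holdsB _ _ _ := rfl
  intB _ _ _ _ _ := Integrable.of_finite
  H2B K t _ _ := by
    show ZD D g₀ os (K + 1) t =
      ∫ x, ∑ a : (Isk (K + 1)).Adm, (toyR (ZD D g₀ os (K + 1) t)).term a x ∂(Measure.dirac ())
    rw [MeasureTheory.integral_dirac, sum_term_toyR (ZD_pos D hM g₀ os (K + 1) t)]
  trunc := trunc₃
  htr K _ := trunc₃_mem K
  dB _ _ _ := 0
  mup _ _ := 0
  sB' K := sBsharp O (O.A₁ ^ 2) C (D.C ⟨K, F.m, g₀ K⟩).flow.g
  φB' _ _ _ := 0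
  φR' _ _ := 0
  upB K _ _ _ k hk := absurd hk (not_mem_badGMems₄ F.L Rc _ _ jhalf K k)
  deadB_nonneg K _ _ _ k hk := absurd hk (not_mem_badGMems₄ F.L Rc _ _ jhalf K k)
  resumB K _ _ _ k hk := absurd hk (not_mem_badGMems₄ F.L Rc _ _ jhalf K k)
  mup_bd _ _ _ _ := ⟨le_rfl, by positivity⟩
  shA := shA
  shB := shB
  Wsh := Wsh
  shell := shell
  Cc := Cc
  Rr := Rr
  CcRec := CcRec
  RrRec := RrRec
  ν := ν
  u := u
  s₂ := s₂
  q₀ := q₀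
  r := r
  s := s
  budget := budget
  sum_r := sum_r
  sum_u := sum_u
  sum_s := sum_s
  sum_s₂ := sum_s₂
  hcΛ := hcΛ
  hΛ K t := log_Λ_toy₄ O (O.A₁ ^ 2) C Lr p₁ Rc cΛ _ (ZD D g₀ os) hΛ1 K t
  hθv := hθv
  hβ₀ := hβ₀
  hLr := hLr
  hΦ := hΦ
  m := O.A₁ ^ 2
  hm := le_rfl
  hexpR := hexpR
  hexpR' := hexpR'
  hexpB := hexpB
  hexpF := hexpF
  hexpV := hexpV
  hη := hη
  hη' := hη'
  hκ := hκ
  hκ₂ := hκ₂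
  hκᵥ := hκᵥ
  hp₀ := hp₀
  hAp := ApFlat_ne_zero hγ₀ hA₁ hMO hLr O.d
  hγ₀ := hγ₀
  hA₁ := hA₁
  hA₀ := hA₀
  hM := hMO
  hβd := hβd
  hφB K _ _ := mul_nonneg hΦ (dshare_nonneg hE₂.le hE₃.le _)
  hφR K _ := mul_nonneg hΦ (dshare_nonneg hE₂.le hE₃.le _)
  hφB' K _ _ := mul_nonneg hΦ (dshare_nonneg hE₂.le hE₃.le _)
  hφR' K _ := mul_nonneg hΦ (dshare_nonneg hE₂.le hE₃.le _)
  hsB _ _ _ := le_rfl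
  hsB' _ _ _ := le_rfl
  p27 := 1
  hp27 := le_rfl
  h27 K _ := h27 K

end Record

end

end Summit.QuantumFields.BalabanUV.T4Continuum.HistoryRealiseCellsRunAssemblyWTVSSanity
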